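import Summits.Parity.GeneralizedHardyLittlewood.Theses.LiouvilleShiftedTables
import Summits.Parity.GeneralizedHardyLittlewood.Theses.RoughSemiprimeRigidity
import Literature.NumberTheory.Sieve.ElliottHalberstamBridgeProofs
import Literature.NumberTheory.Sieve.BombieriVinogradovFacts
import Summits.Parity.GeneralizedHardyLittlewood.Theorems.LiouvilleShiftedTablesEHStubLowConductor
import Summits.Parity.GeneralizedHardyLittlewood.Theorems.LiouvilleShiftedTablesEHStubReplication
import Summits.Parity.GeneralizedHardyLittlewood.Theorems.LiouvilleShiftedTablesEHStubBadModuliHarmonic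
import Summits.Parity.GeneralizedHardyLittlewood.Theorems.LiouvilleShiftedTablesEHStubDescentLog
import Summits.Parity.GeneralizedHardyLittlewood.Theorems.LiouvilleShiftedTablesEHPurityLogOfEH

/-!
# Line `upward-replication-free-factorability`, LOG-SPARSE variant — crux `EH` (stmt-Parity-11314)

Lead c1's complementary skeleton (lead -1 runs the moment reshape of the same line concurrently):
the SAME composition with the purity stub weakened to LOG-sparse impurity
(`#I ≤ x^{1−ε'}/(log x)^{B'}` for every `B'`), which still suffices for the descent because the
bad-moduli harmonic bound is linear in `#I` (`stub_badModuliHarmonic`, LANDED p96517;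
`stub_descentLog`, LANDED p96566).  The log-sparse purity statement is implied by EH (Markov +
`stub_lowConductor`: `PurityLogOfEH.stub_topWindowPurityLog_of_eh`, LANDED p96586), so this variant
is an EQUIVALENCE normal form of the crux (`Theorems/LiouvilleShiftedTablesEHLocalisation.lean`,
`eh_iff_topWindowPurityLog`): its single open stub `stub_topWindowPurityLog` is the Elliott–Halberstam
conjecture itself (= item stmt-Parity-14092 `ElliottHalberstam`, `Iff.rfl` with this crux).

Stubs: `stub_lowConductor` ✓ (p88193), `stub_replication` ✓ (p86395), `stub_topWindowPurityLog` OPEN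
(⟺ EH), `stub_badModuliHarmonic` ✓ (p96517), `stub_descentLog` ✓ (p96566).  One `sorry`.
-/

namespace Summit.Parity.GeneralizedHardyLittlewood.Cruxes.EH.UpwardReplicationLog

/-- H1 (landed). -/
theorem stub_lowConductor :
    ∀ δ₀ : ℝ, 0 < δ₀ → δ₀ < 1 / 2 → ∀ θ : ℝ, θ < 1 → ∀ A : ℝ, 0 < A →
      (fun x : ℝ => ∑ q ∈ Finset.Icc 1 ⌊x ^ θ⌋₊, ⨆ a : (ZMod q)ˣ,
          ‖((Literature.NumberTheory.Sieve.ParityWave0.chebyshevPsiMod q (a : ZMod q) x -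
                  x / (Nat.totient q : ℝ) : ℝ) : ℂ) -
              ((Nat.totient q : ℂ))⁻¹ *
                ∑ χ ∈ (Finset.univ : Finset (DirichletCharacter ℂ q)) with
                    ⌊x ^ (1 / 2 - δ₀)⌋₊ < χ.conductor,
                  χ (a : ZMod q)⁻¹ * Literature.NumberTheory.Sieve.chebyshevPsiChar χ x‖) =O[Filter.atTop]
        fun x : ℝ => x / Real.log x ^ A :=
  Summit.Parity.GeneralizedHardyLittlewood.Theorems.EH.LowConductor.stub_lowConductor

/-- H2 (landed). -/
theorem stub_replication :
    ∀ (D : ℕ) (x : ℝ), 1 ≤ x → ∀ q : ℕ, 1 ≤ q → ∀ p : ℕ, p.Prime → ¬ p ∣ q →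
      (⨆ a : (ZMod q)ˣ,
          ‖((Nat.totient q : ℂ))⁻¹ *
              ∑ χ ∈ (Finset.univ : Finset (DirichletCharacter ℂ q)) with D < χ.conductor,
                χ (a : ZMod q)⁻¹ * Literature.NumberTheory.Sieve.chebyshevPsiChar χ x‖) ≤
        ((p : ℝ) - 1) *
            (⨆ a : (ZMod (q * p))ˣ,
              ‖((Nat.totient (q * p) : ℂ))⁻¹ *
                  ∑ χ ∈ (Finset.univ : Finset (DirichletCharacter ℂ (q * p))) with D < χ.conductor,
                    χ (a : ZMod (q * p))⁻¹ * Literature.NumberTheory.Sieve.chebyshevPsiChar χ x‖) +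
          Literature.NumberTheory.Sieve.nonCoprimePart (q * p) x :=
  Summit.Parity.GeneralizedHardyLittlewood.Theorems.EH.Replication.stub_replication

/-- H3L (OPEN — EQUIVALENT to the crux: `Localisation.eh_iff_topWindowPurityLog`; implied by EH via
`PurityLogOfEH.stub_topWindowPurityLog_of_eh`, p96586) — **log-sparse top-window purity**: for every
window exponent `0 < ε' ≤ 1/2` and all `B, B' > 0` there are a conductor cut `δ₀ ∈ (0,1/2)` and `x₀` such
that for `x ≥ x₀` all moduli `m ∈ (x^{1−ε'}, 2x^{1−ε'}]` outside a set `I` with `#I ≤ x^{1−ε'}/(log x)^{B'}`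
satisfy `E♯_{⌊x^{1/2−δ₀}⌋}(x; m) < x/(φ(m)(log x)^B)`.  Held by the lead; = the Elliott–Halberstam
conjecture (item stmt-Parity-14092). -/
theorem stub_topWindowPurityLog :
    ∀ ε' : ℝ, 0 < ε' → ε' ≤ 1 / 2 → ∀ B : ℝ, 0 < B → ∀ B' : ℝ, 0 < B' →
      ∃ δ₀ : ℝ, 0 < δ₀ ∧ δ₀ < 1 / 2 ∧ ∃ x₀ : ℝ, ∀ x : ℝ, x₀ ≤ x →
        ∃ I : Finset ℕ, (I.card : ℝ) ≤ x ^ (1 - ε') / Real.log x ^ B' ∧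
          ∀ m ∈ Finset.Ioc ⌊x ^ (1 - ε')⌋₊ ⌊2 * x ^ (1 - ε')⌋₊, m ∉ I →
            (⨆ a : (ZMod m)ˣ,
                ‖((Nat.totient m : ℂ))⁻¹ *
                    ∑ χ ∈ (Finset.univ : Finset (DirichletCharacter ℂ m)) with
                        ⌊x ^ (1 / 2 - δ₀)⌋₊ < χ.conductor,
                      χ (a : ZMod m)⁻¹ * Literature.NumberTheory.Sieve.chebyshevPsiChar χ x‖) <
              x / ((Nat.totient m : ℝ) * Real.log x ^ B) := by
  sorry

/-- H4L (KNOWN, LANDED p96517) — **bad moduli: harmonic bound linear in `#I`**. -/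
theorem stub_badModuliHarmonic :
    ∀ ε' θ : ℝ, 0 < ε' → 0 < 1 - ε' - θ →
      ∃ K x₁ : ℝ, ∀ x : ℝ, x₁ ≤ x → ∀ I : Finset ℕ,
        ∀ Bad : Finset ℕ, Bad ⊆ Finset.Icc 1 ⌊x ^ θ⌋₊ →
          (∀ q ∈ Bad, ∀ p : ℕ, p.Prime → ¬ p ∣ q →
              x ^ (1 - ε') / q < p → (p : ℝ) ≤ 2 * x ^ (1 - ε') / q → q * p ∈ I) →
            ∑ q ∈ Bad, ((Nat.totient q : ℝ))⁻¹ ≤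
              K * (I.card : ℝ) / x ^ (1 - ε') * Real.log x ^ 2 :=
  -- landed: p96517
  Summit.Parity.GeneralizedHardyLittlewood.Theorems.EH.BadModuliHarmonic.stub_badModuliHarmonic

/-- H5L (KNOWN, LANDED p96566) — **descent with log-sparse purity**. -/
theorem stub_descentLog :
    (∀ δ₀ : ℝ, 0 < δ₀ → δ₀ < 1 / 2 → ∀ θ : ℝ, θ < 1 → ∀ A : ℝ, 0 < A →
      (fun x : ℝ => ∑ q ∈ Finset.Icc 1 ⌊x ^ θ⌋₊, ⨆ a : (ZMod q)ˣ,
          ‖((Literature.NumberTheory.Sieve.ParityWave0.chebyshevPsiMod q (a : ZMod q) x -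
                  x / (Nat.totient q : ℝ) : ℝ) : ℂ) -
              ((Nat.totient q : ℂ))⁻¹ *
                ∑ χ ∈ (Finset.univ : Finset (DirichletCharacter ℂ q)) with
                    ⌊x ^ (1 / 2 - δ₀)⌋₊ < χ.conductor,
                  χ (a : ZMod q)⁻¹ * Literature.NumberTheory.Sieve.chebyshevPsiChar χ x‖) =O[Filter.atTop]
        fun x : ℝ => x / Real.log x ^ A) →
    (∀ (D : ℕ) (x : ℝ), 1 ≤ x → ∀ q : ℕ, 1 ≤ q → ∀ p : ℕ, p.Prime → ¬ p ∣ q →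
      (⨆ a : (ZMod q)ˣ,
          ‖((Nat.totient q : ℂ))⁻¹ *
              ∑ χ ∈ (Finset.univ : Finset (DirichletCharacter ℂ q)) with D < χ.conductor,
                χ (a : ZMod q)⁻¹ * Literature.NumberTheory.Sieve.chebyshevPsiChar χ x‖) ≤
        ((p : ℝ) - 1) *
            (⨆ a : (ZMod (q * p))ˣ,
              ‖((Nat.totient (q * p) : ℂ))⁻¹ *
                  ∑ χ ∈ (Finset.univ : Finset (DirichletCharacter ℂ (q * p))) with D < χ.conductor,
                    χ (a : ZMod (q * p))⁻¹ * Literature.NumberTheory.Sieve.chebyshevPsiChar χ x‖) +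
          Literature.NumberTheory.Sieve.nonCoprimePart (q * p) x) →
    (∀ ε' : ℝ, 0 < ε' → ε' ≤ 1 / 2 → ∀ B : ℝ, 0 < B → ∀ B' : ℝ, 0 < B' →
      ∃ δ₀ : ℝ, 0 < δ₀ ∧ δ₀ < 1 / 2 ∧ ∃ x₀ : ℝ, ∀ x : ℝ, x₀ ≤ x →
        ∃ I : Finset ℕ, (I.card : ℝ) ≤ x ^ (1 - ε') / Real.log x ^ B' ∧
          ∀ m ∈ Finset.Ioc ⌊x ^ (1 - ε')⌋₊ ⌊2 * x ^ (1 - ε')⌋₊, m ∉ I →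
            (⨆ a : (ZMod m)ˣ,
                ‖((Nat.totient m : ℂ))⁻¹ *
                    ∑ χ ∈ (Finset.univ : Finset (DirichletCharacter ℂ m)) with
                        ⌊x ^ (1 / 2 - δ₀)⌋₊ < χ.conductor,
                      χ (a : ZMod m)⁻¹ * Literature.NumberTheory.Sieve.chebyshevPsiChar χ x‖) <
              x / ((Nat.totient m : ℝ) * Real.log x ^ B)) →
    (∀ ε' θ : ℝ, 0 < ε' → 0 < 1 - ε' - θ →
      ∃ K x₁ : ℝ, ∀ x : ℝ, x₁ ≤ x → ∀ I : Finset ℕ,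
        ∀ Bad : Finset ℕ, Bad ⊆ Finset.Icc 1 ⌊x ^ θ⌋₊ →
          (∀ q ∈ Bad, ∀ p : ℕ, p.Prime → ¬ p ∣ q →
              x ^ (1 - ε') / q < p → (p : ℝ) ≤ 2 * x ^ (1 - ε') / q → q * p ∈ I) →
            ∑ q ∈ Bad, ((Nat.totient q : ℝ))⁻¹ ≤
              K * (I.card : ℝ) / x ^ (1 - ε') * Real.log x ^ 2) →
    Literature.NumberTheory.Sieve.ElliottHalberstamConjecture :=
  -- landed: p96566
  Summit.Parity.GeneralizedHardyLittlewood.Theorems.EH.DescentLog.stub_descentLog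

/-- Composition: the route decl by name. -/
theorem EH_of : Summit.Parity.GeneralizedHardyLittlewood.Theses.LiouvilleShiftedTables.EH :=
  Literature.NumberTheory.Sieve.elliottHalberstam_iff_wave0_holds.mpr
    (stub_descentLog stub_lowConductor stub_replication stub_topWindowPurityLog
      stub_badModuliHarmonic)

theorem EH_of_roughSemiprimeRigidity :
    Summit.Parity.GeneralizedHardyLittlewood.Theses.RoughSemiprimeRigidity.EH :=
  EH_of

/-- Calibration (LANDED p96586): the open stub is implied by the crux — so the line is an equivalence,
not a reduction to something weaker. -/
theorem stub_topWindowPurityLog_of_eh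
    (hEH : Literature.NumberTheory.Sieve.ElliottHalberstamConjecture) :
    ∀ ε' : ℝ, 0 < ε' → ε' ≤ 1 / 2 → ∀ B : ℝ, 0 < B → ∀ B' : ℝ, 0 < B' →
      ∃ δ₀ : ℝ, 0 < δ₀ ∧ δ₀ < 1 / 2 ∧ ∃ x₀ : ℝ, ∀ x : ℝ, x₀ ≤ x →
        ∃ I : Finset ℕ, (I.card : ℝ) ≤ x ^ (1 - ε') / Real.log x ^ B' ∧
          ∀ m ∈ Finset.Ioc ⌊x ^ (1 - ε')⌋₊ ⌊2 * x ^ (1 - ε')⌋₊, m ∉ I →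
            (⨆ a : (ZMod m)ˣ,
                ‖((Nat.totient m : ℂ))⁻¹ *
                    ∑ χ ∈ (Finset.univ : Finset (DirichletCharacter ℂ m)) with
                        ⌊x ^ (1 / 2 - δ₀)⌋₊ < χ.conductor,
                      χ (a : ZMod m)⁻¹ * Literature.NumberTheory.Sieve.chebyshevPsiChar χ x‖) <
              x / ((Nat.totient m : ℝ) * Real.log x ^ B) :=
  Summit.Parity.GeneralizedHardyLittlewood.Theorems.EH.PurityLogOfEH.stub_topWindowPurityLog_of_eh hEH

end Summit.Parity.GeneralizedHardyLittlewood.Cruxes.EH.UpwardReplicationLog
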